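import Mathlib.Algebra.BigOperators.Group.Finset.Basic
import Mathlib.Algebra.Order.BigOperators.Group.Finset
import Mathlib.Data.Fintype.Card
import Mathlib.Tactic.Linarith
import Mathlib.Tactic.NormNum
import Mathlib.Tactic.Ring
import Mathlib.Tactic.IntervalCases
import Mathlib.Tactic.Positivity
import HarnessLib

/-!
# The (0,1) cell of the ι-window, XIV bis: the translation-invariant rank-2 branch — LEMMA T6 (the determinant of the descended sheaf is
# trivial; its local indices are divisible by 4; the (0,1) sheaf is singular at ≥ 8 of the 256 quarter-periods) — algebraic skeleton

Family `hodge`, b2b cell `hweil` (helper of item stmt-HodgeConjecture-2524). Report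
`run/shared/lean/b2b/hodge-weil/b2b-hweil-pv1-g26/H2-ZERO-ONE-14.md` §10 (prover 1 gen 26, ADDENDUM 2). Companion to `WeilTypeLadderH2OddTorsion.lean`
(same seat: the odd-torsion sub-branch) and `WeilTypeLadderH2EvenBranchVoid.lean` (gen 25: COROLLARY EB′). HONEST FRAMING: a structural constraint inside the
ladder's H2 test ((0,1) cell), on the quotient side of the translation-invariant branch; no case of the Hodge conjecture is proved; nothing here is a rung; no
statement of [Markman 2025] or [Perry 2026] is used as a fact. The kernel content is elementary arithmetic; the geometry is the cell's certified items
(holomorphic Lefschetz at isolated fixed points, the determinant rule (D), twisted Lefschetz parity (L⁺) / PROPOSITION Λ₈ for free quotients, H2-CENSUS (4.2)).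

## Setting (report §9.3 / §10)

`X` a ppav fourfold, `F` a rank-2 (0,1) sheaf with `F ≅ t_a^*F`, `a ∈ X[2] ∖ 0`; `π : X → Y = X/⟨a⟩` ((1,2,2,2)-polarised), `F = π^*F̄`, `F̄` simple and
`ῑ`-equivariant (`ῑ = −1_Y`), `χ(F̄,F̄) = 12`, `e₂^ῑ(F̄) = 12`, `e₁^ῑ(F̄) ≤ 1`, so `(χ_ῑ, e₁^ῑ) ∈ {(16,0), (12,1)}`; `Fix ῑ = Y[2] = H₀ ⊔ H₁` with
`H₀ = π(X[2]) = χ_a^⊥` (128 points; `χ_a` the character sheaf of `π`) and `H₁ = {2x = a}/⟨a⟩`; `t(F̄) ≡ 0` on `H₀`; `det F̄ ∈ {𝒪_Y, χ_a}` since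
`π^* det F̄ = det F = 𝒪_X`.
-/

-- mandated namespace `Summit.HodgeConjecture.HodgeConjecture.…` (Problem = Summit) trips `linter.dupNamespace`; the lakefile disables it
-- tree-wide (weak option), restated here so stand-alone elaboration is warning-free too.
set_option linter.dupNamespace false

namespace Summit.HodgeConjecture.HodgeConjecture.WeilTypeLadder

section TranslationInvariantDet

/-!
### LEMMA T6 (report §10) (the determinant of the descended sheaf is trivial, its
local indices are divisible by 4 and vanish wherever it is locally free; the (0,1) sheaf is singular at ≥ 4 of the 128 ῑ-fixed quarter-periods)

`F ≅ t_a^*F` descends to `F̄` on `Y = X/⟨a⟩`; `det F̄ ∈ {𝒪_Y, χ_a}` (`π^* det F̄ = det F = 𝒪_X`); the fixed points of `ῑ = −1_Y` are `Y[2] = H₀ ⊔ H₁` with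
`H₀ = π(X[2]) = χ_a^⊥` (Weil pairing), `t(F̄)|_{H₀} ≡ 0` ((0,1) condition upstairs). The determinant rule for a rank-2 equivariant perfect complex at a fixed
point, `t ≡ 2·[det acts by +1] (mod 4)` (`tq_det_rule`), gives `det = −1` on `H₀`, hence the induced linearisation of `det F̄` is `−e^{det F̄}_*`; for
`det F̄ = χ_a` this is `+1` on all of `H₁`, so `t ≡ 2 (mod 4)` at 128 points and `Σt² ≥ 512 > 256 ≥ 16χ_ῑ` (`tq_chi_a_excluded`): **`det F̄ = 𝒪_Y`** and
`t ∈ 4ℤ` everywhere, `= 0` wherever `F̄` is locally free (eigenvalues `(+1,−1)`). With `Σ_{H₁} t² = 16χ_ῑ ∈ {256, 192}` and `(L⁺)` on `Y` the index vector is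
`4s`, `s ∈ Λ₈` of norm `16` or `12`, and a norm-16 vector of `Λ₈` has at least four non-zero coordinates (`tq_norm16_support`: `16` is not `a²`, `a² + b²` or
`a² + b² + c²` with non-zero entries except `(±4)`, which `(L⁺)` forbids) — so `F̄` is NOT locally free at `≥ 4` (resp. exactly `12`) points of `H₁`.
-/

/-- **LEMMA T6, the determinant rule (report 10.1).** At an isolated fixed point, for a rank-2 `ῑ`-equivariant perfect complex with `p_i`/`n_i` eigenvalues
`+1`/`−1` on `Tor_i`: `t = Σ(−1)^i(p_i − n_i)`, `2 = Σ(−1)^i(p_i + n_i)`, and the action on the determinant line is `(−1)^{Σ n_i}`; hence `t = 2 − 2N` with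
`N := Σ(−1)^i n_i ≡ Σ n_i (mod 2)`, i.e. **`t ≡ 0 (mod 4)` iff the determinant character is `−1`, `t ≡ 2 (mod 4)` iff it is `+1`.** [new] -/
theorem tq_det_rule (t N : ℤ) (ht : t = 2 - 2 * N) : (t % 4 = 0 ↔ N % 2 = 1) ∧ (t % 4 = 2 ↔ N % 2 = 0) := by
  subst ht; constructor <;> omega

/-- **LEMMA T6 (report 10.2): `det F̄ ≠ χ_a`.** If `det F̄ = χ_a` then (the induced linearisation being `−e^{χ_a}_*`, which is `−1` on `H₀` and `+1` on `H₁`)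
`t ≡ 2 (mod 4)` at all `128` points of `H₁`, so `Σ_{Y[2]} t² ≥ 128·4 = 512`; but `Σt² = 16χ_ῑ(F̄) = 16(2e₂ − 4e₁ − 8) ≤ 16·16 = 256` (`e₂ = 12`, `e₁ ∈ {0,1}`).
[new] -/
theorem tq_chi_a_excluded (t : Fin 128 → ℤ) (hmod : ∀ i, t i % 4 = 2) (e1 Ssq : ℤ) (he1 : 0 ≤ e1)
    (hcap : Ssq = 16 * (2 * 12 - 4 * e1 - 8)) (hsum : (Finset.univ.sum fun i => t i ^ 2) ≤ Ssq) : False := by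
  have hpt : ∀ i ∈ (Finset.univ : Finset (Fin 128)), (4 : ℤ) ≤ t i ^ 2 := by
    intro i _
    have h := hmod i
    have hne : t i ≤ -2 ∨ 2 ≤ t i := by omega
    rcases hne with h1 | h1 <;> nlinarith
  have hge : (Finset.univ.sum fun _ : Fin 128 => (4 : ℤ)) ≤ Finset.univ.sum fun i => t i ^ 2 := Finset.sum_le_sum hpt
  have h128 : (Finset.univ.sum fun _ : Fin 128 => (4 : ℤ)) = 512 := by
    rw [Finset.sum_const, Finset.card_univ, Fintype.card_fin]; norm_num
  linarith

/-- **LEMMA T6 (report 10.3): a norm-16 vector of `Λ₈` has at least four non-zero coordinates.** `16` is not a sum of two or three NON-ZERO squares plus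
possibly zeros: if `a, b ≠ 0` then `a² + b² + c² ≠ 16` (so patterns with two or three non-zero entries are impossible), and the one-entry pattern `(±4)` has
character sums `±4 ∉ 8ℤ`, excluded by `(L⁺)`. Hence the descended sheaf `F̄` (case `χ_ῑ = 16`) fails to be locally free at `≥ 4` of the 128 points of `H₁`
(exactly `12` in the case `χ_ῑ = 12`, by the Kasami–Tokura shape of H2-CENSUS §2). [new] -/
theorem tq_norm16_support (a b c : ℤ) (ha : a ≠ 0) (hb : b ≠ 0) : a ^ 2 + b ^ 2 + c ^ 2 ≠ 16 ∧ ¬ ((8 : ℤ) ∣ 4) ∧ ¬ ((8 : ℤ) ∣ -4) := by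
  refine ⟨?_, by decide, by decide⟩
  intro h
  have hc2 : 0 ≤ c ^ 2 := by positivity
  have ha2 : 0 ≤ a ^ 2 := by positivity
  have hb2 : 0 ≤ b ^ 2 := by positivity
  have ha4 : a ≤ 4 ∧ -4 ≤ a := by constructor <;> nlinarith
  have hb4 : b ≤ 4 ∧ -4 ≤ b := by constructor <;> nlinarith
  have hc4 : c ≤ 4 ∧ -4 ≤ c := by constructor <;> nlinarith
  obtain ⟨ha4, ha4'⟩ := ha4
  obtain ⟨hb4, hb4'⟩ := hb4
  obtain ⟨hc4, hc4'⟩ := hc4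
  interval_cases a <;> interval_cases b <;> simp_all <;> interval_cases c <;> omega

/-- **LEMMA T6 (report 10.3), the count upstairs.** Each point of `H₁ = {x : 2x = a}/⟨a⟩` has two preimages in `X`; so the translation-invariant (0,1) sheaf
`F = π^*F̄` is not locally free at `≥ 2·4 = 8` (case `(16,0)`) resp. exactly `2·12 = 24` (case `(12,1)`) of the 256 points `x ∈ X` with `2x = a`. [new] -/
theorem tq_singular_quarter_periods : (2 : ℕ) * 4 = 8 ∧ (2 : ℕ) * 12 = 24 ∧ (128 : ℕ) + 128 = 256 := by
  norm_num

end TranslationInvariantDet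

end Summit.HodgeConjecture.HodgeConjecture.WeilTypeLadder
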